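import Summits.CriticalPhenomena.SAWScalingLimit.Theorems.SAWDefectDecoherenceObservableToSLERNestedGateDefs

/-!
# Strategist s5 — quantifier audit of S1 (`stub_nestedRenewalFatCoSolidR` = item stmt-CriticalPhenomena-17698)

The Negation heading of STRATEGY-CENSUS.md (s5) tests the reading "`∃ N` before `∀ᶠ δ` bounds the NUMBER of
levels".  Under that reading S1 would be false in the limit (a FIXED mesh-independent crosscut is single-crossed
by the b-conditioned critical SAW with probability → 0: continuum bridge heights of the index-5/8 restriction
measure have Hausdorff dimension 3/4 < 1, Alberts–Duminil-Copin arXiv:0909.0203 Thm 1.2).  The kernel facts below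
show the reading is WRONG: in `TameNestedFamily δ R N c S` the number `N` bounds the hexagon-complexity of EACH
level, and with `N = 1` there are already families with unboundedly many pairwise distinct levels
(`S n = hexBall c (min n M)`, nested, all containing `c`), so the count of levels is free to grow like `R/δ`.
-/

noncomputable section

open scoped Classical
open Set Metric
open Literature.Probability.LatticeModels (HexVertex hexGraph hexCenter)
open Summit.CriticalPhenomena.SAWScalingLimit.Theorems.ObservableToSLER.BridgeGate
open Summit.CriticalPhenomena.SAWScalingLimit.Theorems.ObservableToSLER.NestedGate

namespace Summit.CriticalPhenomena.SAWScalingLimit.Cruxes.ObservableToSLER.StrategistS5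

/-- The complexity clause of `TameNestedFamily` with `N = 1` is met by EVERY single lattice hexagon, whatever
its size: `N` counts hexagons per level, not levels. -/
theorem complexity_clause_single_hexagon (t : HexVertex) (k : ℕ) :
    ∃ L : List (HexVertex × ℕ), L.length ≤ 1 ∧
      ∀ v : HexVertex, v ∈ hexBall t k ↔ ∃ tk ∈ L, v ∈ hexBall tk.1 tk.2 := by
  refine ⟨[(t, k)], by simp, fun v => ?_⟩
  simp

/-- Hexagon levels are monotone in the size. -/
theorem hexBall_mono (c : HexVertex) {m n : ℕ} (h : m ≤ n) : hexBall c m ⊆ hexBall c n := by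
  intro v hv i
  exact (hv i).trans (by exact_mod_cast h)

/-- The centre lies in every hexagon level. -/
theorem mem_hexBall_self (c : HexVertex) (n : ℕ) : c ∈ hexBall c n := by
  intro i
  simp

/-- With `N = 1` the nestedness, root and complexity clauses of `TameNestedFamily` hold for the capped
hexagon family `n ↦ hexBall c (min n M)` for EVERY cap `M` — i.e. `M + 1` distinct levels at complexity 1;
the count of levels is not what `N` bounds.  (The two remaining clauses, `R`-locality and preconnectedness,
are metric/graph facts about single hexagons of size `≤ M ≍ R/δ`, not exercised here.) -/
theorem capped_hexagon_family_clauses (c : HexVertex) (M : ℕ) :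
    let S : ℕ → Set HexVertex := fun n => hexBall c (min n M)
    (∀ n, S n ⊆ S (n + 1)) ∧ (∀ n, c ∈ S n) ∧
      (∀ n, ∃ L : List (HexVertex × ℕ), L.length ≤ 1 ∧
        ∀ v : HexVertex, v ∈ S n ↔ ∃ tk ∈ L, v ∈ hexBall tk.1 tk.2) := by
  refine ⟨fun n => hexBall_mono c (by omega), fun n => mem_hexBall_self c _, fun n => ?_⟩
  exact complexity_clause_single_hexagon c _

end Summit.CriticalPhenomena.SAWScalingLimit.Cruxes.ObservableToSLER.StrategistS5

end
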